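import Summits.ABC.StewartYu.PadicG3ParND
import HarnessLib

/-!
# The `𝔑`-threaded `p`-adic Gen-3 record `PadicG3ParN` — the END record at an ARBITRARY coefficient letter `W′ ≥ 1`

Support file (theorems only; no named facts). Cell `abc-stewartyu`, route `YuMatveevShapeRat`, crux r3 `PadicCoreOddRat`
(stmt-ABC-20503); seat p1 (record owner), asked by the line lead p2 (STATUS 2026-08-27T19:09:08Z (2), 19:25:51Z).
WHY: the saturated frame instantiates the record's budget letter as `P.W := W̃ ≥ max(W_datum, log N, log n! + 3 log n)` (plan R40),
but the frame's END obligation is `RecordOdd (c^·) p n P.A Vmax W_datum …` at the DATUM's `W_datum ≤ W̃`. The landed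
`recordOddN` (`PadicG3ParND`) states the record at `P.W`; its proof uses `W` only through `1 ≤ W` (lp-1's generic
`recordOdd_of_facts`), so the same proof gives the record at every `W′ ≥ 1`:
* `recordOddN_W` — `RecordOdd (256^·) p n P.A P.Amax W′ D₀ S₀ X_f D` at every END datum, any `W′ ≥ 1`;
* `recordOddN_end_W` — at the frame's END slots `(D₀N, S₀NV, ⌊2ⁿ·XsV ŜN/(2(n+1))⌋, DN)`;
* `recordOddN_datumW` — with any cell constant `c ≥ 256` and the datum's `Vmax ≥ Amax`: `RecordOdd (c^·) p n P.A Vmax W′ …`.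

## References
* [Nesterenko2003] Yu. V. Nesterenko, LNM 1819 (2003) — §5.2 (5.5), (5.12)–(5.22), Lemmas 5.3–5.4.
-/

noncomputable section

open Finset Real Nat

namespace Summit.ABC.StewartYu

namespace PadicG3ParN

open PadicG3Par (Cb cM cG Cb_pos Cb_le sixtyfour_le_Cb)
open Summit.ABC.StewartYu.RecordExitsNumeric
open Summit.ABC.StewartYu.GenThreeFrameSpecOdd (RecordOdd)

variable {n : ℕ} (P : PadicG3ParN n)

/-- **`RecordOdd (256^·) p n P.A P.Amax W′ D₀ S₀ X_f D` for the `N`-record at ANY letter `W′ ≥ 1`** and every END datum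
`1 ≤ D₀ ≤ D₀N`, `S₀NV ≤ S₀`, `XsV ŜN ≤ 2·X_f + 1`, `1 ≤ Dⱼ ≤ DN j`, under the v2 convention (`N_q = K`, `½ ≤ θ₀`,
`Amax ≤ 2ⁿΩ`, `1 ≤ Aⱼ`) and `gⁿ ≤ K` (proof = `recordOddN`'s, with `P.hW` replaced by `hW'`).
[cite: Nesterenko2003, §5.2 (5.12)–(5.22)] -/
theorem recordOddN_W (hgK : P.g ^ n ≤ (P.K : ℝ)) (hNq : P.Nq = P.K)
    (hθ : (1 / 2 : ℝ) ≤ P.θ₀) (hAmax : P.Amax ≤ 2 ^ n * P.Ω) (hA1 : ∀ j, 1 ≤ P.A j) (p : ℕ) {W' : ℝ} (hW' : 1 ≤ W')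
    {D₀ S₀ Xf : ℕ} {D : Fin n → ℕ} (hD₀1 : 1 ≤ D₀) (hD₀ : D₀ ≤ P.D0N) (hS₀ : P.S0NV ≤ S₀)
    (hXf : P.XsV P.SdN ≤ 2 * Xf + 1) (hD1 : ∀ j, 1 ≤ D j) (hD : ∀ j, D j ≤ P.DN j) :
    RecordOdd (fun m => (256 : ℝ) ^ m) p n P.A P.Amax W' D₀ S₀ Xf D := by
  have hKNq : P.K ≤ P.Nq := hNq.ge
  have hNqK : P.Nq ≤ 2 ^ n * P.K := by rw [hNq]; exact Nat.le_mul_of_pos_left _ (Nat.two_pow_pos n)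
  -- positivity / floors (as for the v2 record)
  have hg1 := P.one_le_g
  have hg0 : 0 < P.g := lt_of_lt_of_le one_pos hg1
  have hK1 : (1 : ℝ) ≤ P.K := by exact_mod_cast P.one_le_K
  have hΩ := P.Ω_pos
  have hΩ1 := P.one_le_Ω hA1
  have hCb64 := sixtyfour_le_Cb
  have hCb0 : (0 : ℝ) ≤ Cb := by linarith
  have hCbn : (1 : ℝ) ≤ Cb ^ n := one_le_pow₀ (by linarith)
  have hL1 := P.one_le_LgV
  have hL0 : (0 : ℝ) ≤ P.LgV := by linarith
  have hXV := P.XV_ge_128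
  have hXV0 : (0 : ℝ) ≤ P.XV := by linarith
  have hgceil1 : (1 : ℝ) ≤ P.gceil := by exact_mod_cast P.one_le_gceil
  have hggc := P.g_le_gceil
  have hgn1 : 1 ≤ P.g ^ (n - 1) := one_le_pow₀ hg1
  have hgnK : P.g ^ (n - 1) ≤ (P.K : ℝ) := (pow_le_pow_right₀ hg1 (Nat.sub_le n 1)).trans hgK
  have hgnpos : 0 < P.g ^ (n - 1) := by positivity
  -- the effective range `X = ⌈g⌉·XV`
  have hXreal : (((P.gceil * P.XV : ℕ) : ℝ)) = (P.gceil : ℝ) * P.XV := by push_cast; ring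
  have hXge : (P.XV : ℝ) ≤ ((P.gceil * P.XV : ℕ) : ℝ) := by
    rw [hXreal]; exact le_mul_of_one_le_left hXV0 hgceil1
  have hXgX : P.g * P.XV ≤ ((P.gceil * P.XV : ℕ) : ℝ) := by
    rw [hXreal]; exact mul_le_mul_of_nonneg_right hggc hXV0
  have hX1 : 1 ≤ P.gceil * P.XV := Nat.mul_pos P.one_le_gceil (le_trans (by omega) P.sixtyfour_le_XV)
  have hX1r : (1 : ℝ) ≤ ((P.gceil * P.XV : ℕ) : ℝ) := by exact_mod_cast hX1
  -- the Siegel constant `c = Cbⁿ/g^{n-1}`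
  obtain ⟨c, hc⟩ : ∃ c : ℝ, c = Cb ^ n / P.g ^ (n - 1) := ⟨_, rfl⟩
  have hc0 : 0 ≤ c := by rw [hc]; positivity
  have hcle : c ≤ Cb ^ n := by rw [hc]; exact div_le_self (by positivity) hgn1
  have hc87 : c ≤ (87 : ℝ) ^ n := hcle.trans (pow_le_pow_left₀ hCb0 Cb_le n)
  have hcΩK : c * P.Ω * P.K = Cb ^ n * P.Ω * P.K / P.g ^ (n - 1) := by rw [hc]; field_simp
  have hcΩK1 : (1 : ℝ) ≤ c * P.Ω * P.K := by
    rw [hcΩK, le_div_iff₀ hgnpos, one_mul]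
    have h1 : (1 : ℝ) ≤ Cb ^ n * P.Ω := one_le_mul_of_one_le_of_one_le hCbn hΩ1
    calc P.g ^ (n - 1) ≤ P.K := hgnK
      _ = 1 * P.K := (one_mul _).symm
      _ ≤ Cb ^ n * P.Ω * P.K := mul_le_mul_of_nonneg_right h1 (by linarith)
  have hXcΩK1 : (1 : ℝ) ≤ ((P.gceil * P.XV : ℕ) : ℝ) * (c * P.Ω * P.K) :=
    one_le_mul_of_one_le_of_one_le hX1r hcΩK1
  -- range facts at depth `ŜN`, `T := 2^{Ŝ′N-1}`
  obtain ⟨hXf1, hXf2⟩ := P.range_factsN hXf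
  have hKT : (2 : ℝ) ^ (n + 22) * P.K < ((2 ^ (P.SdepthN - 1) : ℕ) : ℝ) := by
    exact_mod_cast P.two_pow_mul_K_lt_SdepthN
  have h23 : (2 : ℝ) ^ (n + 23) ≤ ((2 ^ (P.SdepthN - 1) : ℕ) : ℝ) := by
    exact_mod_cast P.two_pow_le_two_pow_SdepthN_pred
  have hxfT : ((2 ^ (P.SdepthN - 1) : ℕ) : ℝ) * ((P.gceil * P.XV : ℕ) : ℝ) < 2 * (Xf : ℝ) + 1 := by
    exact_mod_cast hXf2
  -- the END degree scale `ρ = max ρ₀ 1`, `ρ₀ = K·N·LV/2^{ŜN}`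
  obtain ⟨ρ₀, hρ₀⟩ : ∃ ρ₀ : ℝ, ρ₀ = (P.K : ℝ) * P.N * P.LV / 2 ^ P.SdN := ⟨_, rfl⟩
  have hρ₀lt : ρ₀ < (P.LgV : ℝ) / 2 ^ (n + 23) := by rw [hρ₀]; exact P.rhoN_lt
  have hρ1 : (1 : ℝ) ≤ max ρ₀ 1 := le_max_right _ _
  have hρ₀le : ρ₀ ≤ max ρ₀ 1 := le_max_left _ _
  have hone : (1 : ℝ) < (P.LgV : ℝ) / 2 ^ (n + 23) := by
    have hL : (2 : ℝ) ^ (n + 25) ≤ P.LgV := by exact_mod_cast P.two_pow_le_LgV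
    have hlt : (2 : ℝ) ^ (n + 23) < 2 ^ (n + 25) := pow_lt_pow_right₀ (by norm_num) (by omega)
    rw [lt_div_iff₀ (by positivity), one_mul]
    linarith
  have hρlt : max ρ₀ 1 < (P.LgV : ℝ) / 2 ^ (n + 23) := max_lt hρ₀lt hone
  have hDρ : ∀ j, (D j : ℝ) ≤ max ρ₀ 1 / P.A j + 1 := by
    intro j
    have hA := P.A_pos j
    have h1 : (D j : ℝ) ≤ P.DN j := by exact_mod_cast hD j
    have h2 := P.DN_le_rhoN_div j
    rw [← hρ₀] at h2
    have h3 : ρ₀ / P.A j ≤ max ρ₀ 1 / P.A j := div_le_div_of_nonneg_right hρ₀le hA.le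
    linarith
  -- the box of clause (C)
  have h24 := P.core_Ω_le_LgV hgK
  have hΛL : max ρ₀ 1 + P.Amax ≤ (((2 : ℝ) ^ (n + 23))⁻¹ + 2 ^ n / (24 * Cb ^ n)) * P.LgV := by
    have h1 : max ρ₀ 1 ≤ ((2 : ℝ) ^ (n + 23))⁻¹ * P.LgV := by
      rw [inv_mul_eq_div]; exact hρlt.le
    have h2 : P.Amax ≤ 2 ^ n / (24 * Cb ^ n) * P.LgV := by
      have hCbn0 : (0 : ℝ) < 24 * Cb ^ n := by positivity
      calc P.Amax ≤ 2 ^ n * P.Ω := hAmax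
        _ = 2 ^ n / (24 * Cb ^ n) * (24 * Cb ^ n * P.Ω) := by field_simp
        _ ≤ 2 ^ n / (24 * Cb ^ n) * P.LgV := mul_le_mul_of_nonneg_left h24 (by positivity)
    have e : (((2 : ℝ) ^ (n + 23))⁻¹ + 2 ^ n / (24 * Cb ^ n)) * P.LgV =
        ((2 : ℝ) ^ (n + 23))⁻¹ * P.LgV + 2 ^ n / (24 * Cb ^ n) * P.LgV := by ring
    rw [e]; linarith
  -- `LgV ≤ (264 Cbⁿ + 2^{2n+26}) K Ω`
  have hgK' : P.g ≤ (P.K : ℝ) := by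
    have : P.g ≤ P.g ^ n := le_self_pow₀ hg1 (by have := P.hn; omega)
    linarith
  have hLKΩ : (P.LgV : ℝ) ≤ (264 * Cb ^ n + 2 ^ (2 * n + 26)) * P.K * ∏ j, P.A j :=
    P.LgV_le_KΩ hθ hNqK hAmax hA1 hgK'
  -- exit B scalars
  have hcore0 : 0 < Cb ^ n * P.Ω * P.K := by positivity
  have eΩ : c * (∏ j, P.A j) * P.K = c * P.Ω * P.K := rfl
  have h3L : (3 / 2 : ℝ) * (n + 1) * P.LgV ≤ ((P.gceil * P.XV : ℕ) : ℝ) * (c * (∏ j, P.A j) * P.K) := by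
    have hXE := P.XE_le_XV
    rw [div_le_iff₀ hcore0] at hXE
    rw [eΩ, hcΩK, mul_div_assoc', le_div_iff₀ hgnpos]
    calc (3 / 2 : ℝ) * (n + 1) * P.LgV * P.g ^ (n - 1) ≤ P.XV * (Cb ^ n * P.Ω * P.K) := hXE
      _ ≤ ((P.gceil * P.XV : ℕ) : ℝ) * (Cb ^ n * P.Ω * P.K) := mul_le_mul_of_nonneg_right hXge hcore0.le
  have hD₀V : (D₀ : ℝ) ≤ P.D0V := by exact_mod_cast hD₀.trans P.D0N_le_D0V
  have hD₀8 : (D₀ : ℝ) ≤ 8 * ((P.gceil * P.XV : ℕ) : ℝ) * (c * (∏ j, P.A j) * P.K) := by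
    have h2 : (P.D0V : ℝ) < 6 * P.XV * (Cb ^ n * P.Ω * P.K / P.g ^ (n - 1)) + 2 := by
      have h := P.L0V_lt
      have e : 6 * (P.XV : ℝ) * Cb ^ n * P.Ω * P.K / P.g ^ (n - 1) =
          6 * P.XV * (Cb ^ n * P.Ω * P.K / P.g ^ (n - 1)) := by field_simp
      unfold PadicG3Par.D0V; push_cast; linarith
    rw [eΩ]
    rw [← hcΩK] at h2
    have hq : 0 ≤ c * P.Ω * P.K := by linarith
    have h5 : (P.XV : ℝ) * (c * P.Ω * P.K) ≤ ((P.gceil * P.XV : ℕ) : ℝ) * (c * P.Ω * P.K) :=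
      mul_le_mul_of_nonneg_right hXge hq
    linarith [hXcΩK1, h5, hD₀V, h2]
  have hD₀q : (D₀ : ℝ) ≤ ((P.gceil * P.XV : ℕ) : ℝ) * P.LgV / 4 + 2 := by
    have h2 := P.D0V_le'
    have h3 : P.g * P.XV * P.LgV ≤ ((P.gceil * P.XV : ℕ) : ℝ) * P.LgV :=
      mul_le_mul_of_nonneg_right hXgX hL0
    linarith
  have hS : 16 * (n + 1) * P.LgV < (S₀ + 1) * (n + 2) ^ 4 :=
    lt_of_lt_of_le P.MV_lt_S0NV_succ_mul (Nat.mul_le_mul_right _ (by omega))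
  have hL24 : 2 ^ (n + 24) ≤ P.LgV :=
    le_trans (Nat.pow_le_pow_right (by norm_num) (by omega)) P.two_pow_le_LgV
  exact recordOdd_of_facts P.hn hA1 P.hAmax P.hAmax1 hW' p (PadicG3Par.pow256_admissible n).1
    (PadicG3Par.pow256_admissible n).2 hX1 hL24 hD₀1 hD₀q hXf1 hS hD1 hDρ hρ1 hρlt hK1 hc0 hc87 h3L hD₀8
    h23 hxfT hKT hΛL hLKΩ


/-- **The `N`-record at the frame's END slots, any letter `W′ ≥ 1`** (`p ≥ 3`, `K₀ ≥ p − 1`, `N_q = K`, `½ ≤ θ₀`,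
`Amax ≤ 2ⁿΩ`, `1 ≤ Aⱼ`): `RecordOdd (256^·) p n P.A P.Amax W′ D₀N S₀NV ⌊2ⁿ·XsV ŜN/(2(n+1))⌋ DN`.
[cite: Nesterenko2003, §5.2 (5.12)–(5.22)] -/
theorem recordOddN_end_W (hp3 : 3 ≤ P.p) (hK₀ : (P.p : ℝ) - 1 ≤ P.K₀) (hNq : P.Nq = P.K)
    (hθ : (1 / 2 : ℝ) ≤ P.θ₀) (hAmax : P.Amax ≤ 2 ^ n * P.Ω) (hA1 : ∀ j, 1 ≤ P.A j) (p : ℕ) {W' : ℝ} (hW' : 1 ≤ W') :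
    RecordOdd (fun m => (256 : ℝ) ^ m) p n P.A P.Amax W' P.D0N P.S0NV
      (2 ^ n * P.XsV P.SdN / (2 * (n + 1))) P.DN :=
  P.recordOddN_W (P.pow_g_le_K hp3 hK₀) hNq hθ hAmax hA1 p hW' P.one_le_D0N le_rfl le_rfl
    P.XsV_SdN_le_two_mul_add_one P.one_le_DN (fun _ => le_rfl)

/-- **The `N`-record at the END slots with any cell constant `c ≥ 256`, the datum's height bound `Vmax ≥ Amax`, and the
DATUM's coefficient letter `W′ ≥ 1`** (the frame's `RecordOdd (c^·) p n P.A Vmax W_datum …`, p2's `recordOddN_datumW`).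
[cite: Nesterenko2003, §5.2 (5.12)–(5.22)] -/
theorem recordOddN_datumW (hp3 : 3 ≤ P.p) (hK₀ : (P.p : ℝ) - 1 ≤ P.K₀) (hNq : P.Nq = P.K)
    (hθ : (1 / 2 : ℝ) ≤ P.θ₀) (hAmax : P.Amax ≤ 2 ^ n * P.Ω) (hA1 : ∀ j, 1 ≤ P.A j)
    {Vmax : ℝ} (hAmaxV : P.Amax ≤ Vmax) (p : ℕ) {c : ℝ} (hc : 256 ≤ c) {W' : ℝ} (hW' : 1 ≤ W') :
    RecordOdd (fun m => c ^ m) p n P.A Vmax W' P.D0N P.S0NV (2 ^ n * P.XsV P.SdN / (2 * (n + 1))) P.DN := by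
  have hrec := P.recordOddN_end_W hp3 hK₀ hNq hθ hAmax hA1 p hW'
  have hW0 : 0 ≤ W' := by linarith
  have h256 := GenThreeFrameSpecOdd.recordOdd_mono_base (by norm_num : (1 : ℝ) ≤ 256) hc hA1 hW0 P.hAmax1 hrec
  exact GenThreeFrameSpecOdd.recordOdd_mono_Vmax (fun r => by positivity) P.hn hA1 hW0 P.hAmax1 hAmaxV h256

end PadicG3ParN

end Summit.ABC.StewartYu
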